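import Literature.AlgebraicGeometry.Motives.HodgeStructureExteriorAlgebraLefschetzInvolution
import Literature.Algebra.Lie.LefschetzModuleWeylOperator
import HarnessLib

/-!
# The Weyl operator `w = exp(Λ_ω) exp(−e_ω) exp(Λ_ω)` and André's Hodge involution `*_H` on the exterior algebra of a symplectic space
# ("l'élément `(0 1 ; −1 0)` de `SL₂` s'envoie sur `± *_H`", André 1996 §1.2; `*_H L *_H = ᶜΛ`)

[topic AlgebraicGeometry/Motives]

Layer `Literature/AlgebraicGeometry/Motives`, lane `lit-hodgefound` (Track 2 foundations library; prover seat `lit-hodgefound-p34`,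
generation 31, row g31-#3).  DEFINITIONS WITH BODIES (`weylStar`, `andreStar` — the abstract `HasLefschetzProperty.weylOperator` /
`HasLefschetzProperty.andreHodgeInvolution` of `Algebra/Lie/LefschetzModuleWeylOperator` (row g31-#1) EVALUATED on the Lefschetz module
`(⋀ W, h = l − g, e_ω = ω ∧ ·)` of row g29-#1 `Motives/HodgeStructureExteriorAlgebraLefschetzModule`, junk value `0` when `ω` is not
symplectic of genus `g`, exactly as `lefschetzStar ω g` / `hodgeStar ω g` of row g29-#4) and PROVED theorems; no named fact, no instance,
no notation (D-0026 net debt `0`).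

## Sources, VERBATIM

Y. André, *Pour une théorie inconditionnelle des motifs*, Publ. Math. IHÉS **83** (1996) [Andre1996Motifs] (held
`paper:doi-10-1007-bf02698643`, OCR of the Numdam scan), §1.1 (p. 10): "On définit aussi les involutions de Lefschetz et de Hodge
respectivement par les formules : `*_L x = Σ L^{d−j+k} x_{j−2k}`, `*_H x = Σ (−1)^{(j−2k)(j−2k+1)/2} (k!/(d−j+k)!) L^{d−j+k} x_{j−2k}`";
(p. 11): "l'opérateur `ᶜL = *_L L *_L`, proportionnel à `ᶜΛ` sur chaque composante de Lefschetz, est un inverse à droite de `L` sur l'image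
de `L`"; §1.2 (p. 11): "On en déduit une représentation de `𝔰𝔩₂` sur `H*(X)`, attachée à `η` : `ᶜΛ ↦ (0 1 ; 0 0)`, `L ↦ (0 0 ; 1 0)`,
`h ↦ (1 0 ; 0 −1)`. […] De plus, un calcul sans difficulté montre que l'élément `(0 1 ; −1 0)` de `SL₂` s'envoie sur `± *_H`, le signe
étant `(−1)^{…}` sur la composante `Hʲ`" (exponent unreadable in the scan; proved: `(−1)^{d + j(j−1)/2}`, g31-#1).
J. S. Milne, *Lefschetz classes on abelian varieties*, Duke Math. J. **96** (1999) [Milne1999LefschetzClasses], p. 664: "`ᶜΛx = Σ i(d−s+i+1)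
L^{i−1} xᵢ`, `*x = Σ (−1)^{(s−2i)(s−2i+1)/2} L^{d−s+i} xᵢ`" (Milne's `∗` = Kleiman's `⋆` = the tree's `hodgeStar ω g`, WITHOUT André's
factor); Thm. 5.9, proof (p. 665): "all elements of the `ℚ`-algebra `ℚ[L, Λ]` are Lefschetz".
E. Looijenga, V. A. Lunts, Invent. Math. **129** (1997) [LooijengaLunts1997], §3 (3.3) (p. 13): "`f_κ` is defined and equal to
`Σ i_{a_{−k}} i_{a_k}`" (the `𝔰𝔩₂`-partner of `e_κ = κ ∧ ·` on `∧•V*`; the tree's `lefschetzDual ω g`, g29-#1 `dual_eq_lefschetzDual`).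
H. Lange, *Abelian Varieties over the Complex Numbers* (2023) [Lange2023AbelianVarietiesComplex], §7.3.2 (1)–(2) (p. 338): `L^{g−k}`
"is an isomorphism, which is `Sp(V, E)`-equivariant".

## Reading, and what is PROVED

`K` a field of characteristic `0`, `ω : ExteriorAlgebra K W` with `IsSymplectic ω g` (`dim W = 2g`; André's `d = g`, `Hˢ = ⋀ˢ W`,
`L = e_ω = ω ∧ ·`, `ᶜΛ = Λ_ω = lefschetzDual ω g`, primitive `p ∈ Pᵏ = primitive ω g k`, strings `p, ω ∧ p, …, ω^{g−k} ∧ p`).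

* §1 `weylStar ω g` (`w`), `andreStar ω g` (André's `*_H` with its factor): **`IsSymplectic.weylStar_apply_pow_mul_of_mem_primitive`**
  (`w (ωʳ ∧ p) = (−1)^{g−k+r} (r!/(g−k−r)!) ω^{g−k−r} ∧ p`), `…_apply_of_mem_primitive` (`w p = (−1)^{g−k} ω^{g−k} ∧ p/(g−k)!`),
  `…_apply_pow_mul_top` (`w (ω^{g−k} ∧ p) = (g−k)! p`), **`IsSymplectic.andreStar_apply_pow_mul_of_mem_primitive`** (ANDRÉ'S PRINTED
  FORMULA `*_H (ωʳ ∧ p) = (−1)^{k(k+1)/2} (r!/(g−k−r)!) ω^{g−k−r} ∧ p`), `IsSymplectic.andreStar_apply_pow_mul_eq_smul_hodgeStar`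
  (`*_H = (r!/(g−k−r)!) ∗` on `ωʳ ∧ Pᵏ`), `IsSymplectic.andreStar_mul_self` (`*_H² = 1`), `IsSymplectic.weylStar_pow_four`,
  **`IsSymplectic.weylStar_weylStar_apply_of_mem`** (`w² = (−1)^{k+g}` on `⋀ᵏ W`: the central `−1 ∈ SL₂`), `…_apply_mem` (`⋀ᵏ → ⋀^{2g−k}`).
* §2 the `𝔰𝔩₂`-relations and the algebra `K[e_ω, Λ_ω]`: **`IsSymplectic.weylStar_mul_mul`** (`w e_ω = −Λ_ω w`),
  **`IsSymplectic.weylStar_mul_lefschetzDual`** (`w Λ_ω = −e_ω w`), `IsSymplectic.weylStar_mul_shiftedDegree` (`w h = −h w`),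
  **`IsSymplectic.andreStar_mul_mul_andreStar`** (`*_H e_ω *_H = Λ_ω = ᶜΛ` EXACTLY — the factor is what turns "proportionnel à ᶜΛ"
  into equality), `IsSymplectic.weylStar_mem_adjoin_lefschetzStar` / `…andreStar_mem_adjoin_lefschetzStar` (`w, *_H ∈ K[e_ω, *_L]`),
  `IsSymplectic.weylStar_mem_adjoin_lefschetzDual` (`w ∈ K[e_ω, Λ_ω]`), **`IsSymplectic.adjoin_pair_andreStar_eq_adjoin_pair_lefschetzDual`**
  (`K[e_ω, *_H] = K[e_ω, Λ_ω]`, Prop. 1.2).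
* §3 **`IsSymplectic.andreStar_apply_of_mem`** ("`(0 1 ; −1 0)` s'envoie sur `± *_H`": `*_H x = (−1)^{g + C(k,2)} w x` on `⋀ᵏ W`).
* §4 `Sp(ω)`-EQUIVARIANCE: **`IsSymplectic.map_weylStar`**, **`IsSymplectic.map_andreStar`** (`⋀(f) ∘ w = w ∘ ⋀(f)` etc. for `⋀(f) ω = ω`).

## SCOPE

The tensor/product sorites (André §1.3; abstractly `Algebra/Lie/LefschetzModuleWeylOperatorTensor`, row g31-#2) need the Künneth
isomorphism `⋀(W₁ ⊕ W₂) ≅ ⋀ W₁ ⊗ ⋀ W₂` of Lefschetz modules, not in this file; the polarized-Hodge-structure carrier and base change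
to `ℂ` (cf. rows g29-#6, g30-#2) are not treated here.

## References

* [Andre1996Motifs] Y. André, *Pour une théorie inconditionnelle des motifs*, Publ. Math. IHÉS 83 (1996), §1.1 (pp. 10–11), §1.2 (p. 11),
  Prop. 1.2.
* [Milne1999LefschetzClasses] J. S. Milne, *Lefschetz classes on abelian varieties*, Duke Math. J. 96 (1999) 639–675, §5 p. 664 (ᶜΛ, ∗),
  Thm. 5.9 with proof (p. 665).
* [LooijengaLunts1997] E. Looijenga, V. A. Lunts, *A Lie algebra attached to a projective variety*, Invent. Math. 129 (1997), §3 (3.3).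
* [Lange2023AbelianVarietiesComplex] H. Lange, *Abelian Varieties over the Complex Numbers* (2023), §7.3.2 (1)–(2) (p. 338).
* [Kleiman1968AlgebraicCycles] S. L. Kleiman, *Algebraic cycles and the Weil conjectures* (1968), §1.4 (1.4.2, 1.4.6).
-/

noncomputable section

namespace Literature.AlgebraicGeometry.Motives.ExteriorLefschetz

open Literature.Algebra.Lie ExteriorAlgebra Module Function Set
open scoped Nat
open Literature.Algebra.Lie.HasLefschetzProperty (primitiveSpace mem_primitiveSpace_iff)

universe u v

section Def

variable {K : Type u} [Field K] [CharZero K] {W : Type v} [AddCommGroup W] [Module K W]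

/-- **The Weyl operator `w = exp(Λ_ω) exp(−e_ω) exp(Λ_ω)` of the exterior algebra of a 2-vector `ω` of genus `g`** — the image of
`(0 1 ; −1 0) ∈ SL₂` under André's representation `ᶜΛ ↦ (0 1 ; 0 0)`, `L ↦ (0 0 ; 1 0)`: the abstract `HasLefschetzProperty.weylOperator`
of the Lefschetz module `(⋀ W, h, e_ω)` (row g29-#1); junk value `0` if `ω` is not symplectic of genus `g`.
[cite: Andre1996Motifs, §1.2 (p. 11, "l'élément (0 1 ; −1 0) de SL₂")] -/
def weylStar (ω : ExteriorAlgebra K W) (g : ℕ) : Module.End K (ExteriorAlgebra K W) :=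
  open Classical in
  if hω : IsSymplectic ω g then
    hω.hasLefschetzProperty_mul.weylOperator (isZGrading_shiftedDegree K (fun i : ℕ ↦ ⋀[K]^i W) g)
  else 0

/-- **André's Hodge involution `*_H` of the exterior algebra of a 2-vector `ω` of genus `g`, WITH its factor**
("`*_H x = Σ (−1)^{(j−2k)(j−2k+1)/2} (k!/(d−j+k)!) L^{d−j+k} x_{j−2k}`", `d = g`): the abstract `HasLefschetzProperty.andreHodgeInvolution`
of `(⋀ W, h, e_ω)` with `d = g`; junk value `0` otherwise.  (The factorial-free `hodgeStar ω g` of row g29-#4 is Milne's `∗` / Kleiman's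
`⋆`.) [cite: Andre1996Motifs, §1.1 (p. 10, "involutions de Lefschetz et de Hodge")] -/
def andreStar (ω : ExteriorAlgebra K W) (g : ℕ) : Module.End K (ExteriorAlgebra K W) :=
  open Classical in
  if hω : IsSymplectic ω g then
    hω.hasLefschetzProperty_mul.andreHodgeInvolution (isZGrading_shiftedDegree K (fun i : ℕ ↦ ⋀[K]^i W) g) g
  else 0

/-- Junk value of `w`. [cite: Andre1996Motifs, §1.2 (p. 11)] -/
theorem weylStar_of_not {ω : ExteriorAlgebra K W} {g : ℕ} (h : ¬IsSymplectic ω g) : weylStar ω g = 0 := by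
  classical
  exact dif_neg h

/-- Junk value of `*_H`. [cite: Andre1996Motifs, §1.1 (p. 10)] -/
theorem andreStar_of_not {ω : ExteriorAlgebra K W} {g : ℕ} (h : ¬IsSymplectic ω g) : andreStar ω g = 0 := by
  classical
  exact dif_neg h

variable {ω : ExteriorAlgebra K W} {g : ℕ}

/-- `w` is the abstract Weyl operator of `(⋀ W, h, e_ω)`. [cite: Andre1996Motifs, §1.2 (p. 11)] -/
theorem IsSymplectic.weylStar_eq (hω : IsSymplectic ω g) :
    weylStar ω g = hω.hasLefschetzProperty_mul.weylOperator (isZGrading_shiftedDegree K (fun i : ℕ ↦ ⋀[K]^i W) g) := by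
  classical
  exact dif_pos hω

/-- `*_H` is the abstract André involution of `(⋀ W, h, e_ω)` with `d = g`. [cite: Andre1996Motifs, §1.1 (p. 10)] -/
theorem IsSymplectic.andreStar_eq (hω : IsSymplectic ω g) :
    andreStar ω g = hω.hasLefschetzProperty_mul.andreHodgeInvolution (isZGrading_shiftedDegree K (fun i : ℕ ↦ ⋀[K]^i W) g) g := by
  classical
  exact dif_pos hω

end Def

/-! ## §1 The formulas of `w` and `*_H` on the strings `ωʳ ∧ Pᵏ` -/

section Formulas

variable {K : Type u} [Field K] [CharZero K] {W : Type v} [AddCommGroup W] [Module K W]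
variable {ω : ExteriorAlgebra K W} {g : ℕ}

omit [CharZero K] in
/-- `(-1)ᵃ = (-1)ᵇ` when `a + b` is even. [folklore] -/
private theorem neg_one_pow_eq_of_even_add {a b : ℕ} (h : Even (a + b)) : (-1 : K) ^ a = (-1 : K) ^ b := by
  have h1 : (-1 : K) ^ a * (-1 : K) ^ b = 1 := by rw [← pow_add, h.neg_one_pow]
  have h2 : (-1 : K) ^ b * (-1 : K) ^ b = 1 := by rw [← pow_add, ← two_mul, pow_mul, neg_one_sq, one_pow]
  calc (-1 : K) ^ a = (-1 : K) ^ a * ((-1 : K) ^ b * (-1 : K) ^ b) := by rw [h2, mul_one]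
    _ = (-1 : K) ^ b := by rw [← mul_assoc, h1, one_mul]

/-- The dictionary `Pᵏ = P_{-(g-k)}` of g29-#1, membership form. [cite: LooijengaLunts1997, §2 (2.2)] -/
private theorem mem_primitiveSpace_of_mem_primitive {k : ℕ} (hk : k ≤ g) {p : ExteriorAlgebra K W} (hp : p ∈ primitive ω g k) :
    p ∈ primitiveSpace (shiftedDegree K (fun i : ℕ ↦ ⋀[K]^i W) g) (LinearMap.mul K (ExteriorAlgebra K W) ω) (g - k) := by
  rw [primitiveSpace_shiftedDegree_mul_eq_primitive ω g (by omega : g - k ≤ g), show g - (g - k) = k by omega]; exact hp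

/-- **THE WEYL OPERATOR ON A LEFSCHETZ COMPONENT: `w (ωʳ ∧ p) = (−1)^{g−k+r} (r!/(g−k−r)!) ω^{g−k−r} ∧ p`** for `p ∈ Pᵏ` (`k ≤ g`),
`r ≤ g − k` (the string `p, ω ∧ p, …, ω^{g−k} ∧ p` is a copy of `S^{g−k}`, on which `(0 1 ; −1 0)` reverses the weights with these
signs and factorials). [cite: Andre1996Motifs, §1.2 (p. 11, "(0 1 ; −1 0) … s'envoie sur ± *_H")] [cite: Andre1996Motifs, §1.1 (p. 10, the factor k!/(d−j+k)!)] -/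
theorem IsSymplectic.weylStar_apply_pow_mul_of_mem_primitive (hω : IsSymplectic ω g) {k : ℕ} (hk : k ≤ g) {p : ExteriorAlgebra K W}
    (hp : p ∈ primitive ω g k) {r : ℕ} (hr : r ≤ g - k) :
    weylStar ω g (ω ^ r * p) = ((-1 : K) ^ (g - k + r) * ((r ! : ℕ) : K) * (((g - k - r) ! : ℕ) : K)⁻¹) • (ω ^ (g - k - r) * p) := by
  haveI := hω.finiteDimensional_exteriorAlgebra
  have h1 := hω.hasLefschetzProperty_mul.weylOperator_apply_pow_primitive (isZGrading_shiftedDegree K (fun i : ℕ ↦ ⋀[K]^i W) g)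
    (mem_primitiveSpace_of_mem_primitive hk hp) hr
  simp only [mul_pow_eq_mul_pow, LinearMap.mul_apply'] at h1
  rw [hω.weylStar_eq, h1]

/-- `w p = ((−1)^{g−k}/(g−k)!) ω^{g−k} ∧ p` for a primitive `p ∈ Pᵏ`. [cite: Andre1996Motifs, §1.2 (p. 11)] -/
theorem IsSymplectic.weylStar_apply_of_mem_primitive (hω : IsSymplectic ω g) {k : ℕ} (hk : k ≤ g) {p : ExteriorAlgebra K W}
    (hp : p ∈ primitive ω g k) : weylStar ω g p = ((-1 : K) ^ (g - k) * (((g - k) ! : ℕ) : K)⁻¹) • (ω ^ (g - k) * p) := by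
  have h1 := hω.weylStar_apply_pow_mul_of_mem_primitive hk hp (Nat.zero_le _) (r := 0)
  rwa [pow_zero, one_mul, add_zero, Nat.sub_zero, Nat.factorial_zero, Nat.cast_one, mul_one] at h1

/-- `w (ω^{g−k} ∧ p) = (g−k)! · p`: the top of a string goes to `(g−k)!` times its bottom. [cite: Andre1996Motifs, §1.2 (p. 11)] -/
theorem IsSymplectic.weylStar_apply_pow_mul_top (hω : IsSymplectic ω g) {k : ℕ} (hk : k ≤ g) {p : ExteriorAlgebra K W}
    (hp : p ∈ primitive ω g k) : weylStar ω g (ω ^ (g - k) * p) = (((g - k) ! : ℕ) : K) • p := by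
  rw [hω.weylStar_apply_pow_mul_of_mem_primitive hk hp le_rfl, Nat.sub_self, Nat.factorial_zero, Nat.cast_one, inv_one, mul_one,
    pow_zero, one_mul, ← two_mul, pow_mul, neg_one_sq, one_pow, one_mul]

/-- **ANDRÉ'S `*_H` ON A LEFSCHETZ COMPONENT, AS PRINTED: `*_H (ωʳ ∧ p) = (−1)^{k(k+1)/2} (r!/(g−k−r)!) ω^{g−k−r} ∧ p`** for `p ∈ Pᵏ`,
`r ≤ g − k` ("`*_H x = Σ (−1)^{(j−2k)(j−2k+1)/2} (k!/(d−j+k)!) L^{d−j+k} x_{j−2k}`": the primitive class `x_{j−2k} = p` has degree `k`,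
sits at position `r` of its string, and `d = g`, `d − j + k = g − k − r`). [cite: Andre1996Motifs, §1.1 (p. 10)] -/
theorem IsSymplectic.andreStar_apply_pow_mul_of_mem_primitive (hω : IsSymplectic ω g) {k : ℕ} (hk : k ≤ g) {p : ExteriorAlgebra K W}
    (hp : p ∈ primitive ω g k) {r : ℕ} (hr : r ≤ g - k) :
    andreStar ω g (ω ^ r * p) = ((-1 : K) ^ (k * (k + 1) / 2) * ((r ! : ℕ) : K) * (((g - k - r) ! : ℕ) : K)⁻¹) • (ω ^ (g - k - r) * p) := by
  haveI := hω.finiteDimensional_exteriorAlgebra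
  have h1 := hω.hasLefschetzProperty_mul.andreHodgeInvolution_apply_pow_primitive (isZGrading_shiftedDegree K (fun i : ℕ ↦ ⋀[K]^i W) g)
    g (mem_primitiveSpace_of_mem_primitive hk hp) hr
  simp only [mul_pow_eq_mul_pow, LinearMap.mul_apply', show g - (g - k) = k by omega] at h1
  rw [hω.andreStar_eq, h1]

/-- `*_H p = ((−1)^{k(k+1)/2}/(g−k)!) ω^{g−k} ∧ p` for a primitive `p ∈ Pᵏ`. [cite: Andre1996Motifs, §1.1 (p. 10)] -/
theorem IsSymplectic.andreStar_apply_of_mem_primitive (hω : IsSymplectic ω g) {k : ℕ} (hk : k ≤ g) {p : ExteriorAlgebra K W}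
    (hp : p ∈ primitive ω g k) :
    andreStar ω g p = ((-1 : K) ^ (k * (k + 1) / 2) * (((g - k) ! : ℕ) : K)⁻¹) • (ω ^ (g - k) * p) := by
  have h1 := hω.andreStar_apply_pow_mul_of_mem_primitive hk hp (Nat.zero_le _) (r := 0)
  rwa [pow_zero, one_mul, Nat.sub_zero, Nat.factorial_zero, Nat.cast_one, mul_one] at h1

/-- **André's `*_H` is Milne's `∗` rescaled: `*_H (ωʳ ∧ p) = (r!/(g−k−r)!) · ∗(ωʳ ∧ p)`** (`p ∈ Pᵏ`, `r ≤ g − k`).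
[cite: Andre1996Motifs, §1.1 (p. 10)] [cite: Milne1999LefschetzClasses, §5 p. 664] -/
theorem IsSymplectic.andreStar_apply_pow_mul_eq_smul_hodgeStar (hω : IsSymplectic ω g) {k : ℕ} (hk : k ≤ g) {p : ExteriorAlgebra K W}
    (hp : p ∈ primitive ω g k) {r : ℕ} (hr : r ≤ g - k) :
    andreStar ω g (ω ^ r * p) = (((r ! : ℕ) : K) * (((g - k - r) ! : ℕ) : K)⁻¹) • hodgeStar ω g (ω ^ r * p) := by
  rw [hω.andreStar_apply_pow_mul_of_mem_primitive hk hp hr, hω.hodgeStar_apply_pow_mul_of_mem_primitive hk hp hr, smul_smul]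
  congr 1
  ring

/-- **`*_H` is an involution of `⋀ W`.** [cite: Andre1996Motifs, §1.1 (p. 10, "involutions")] -/
theorem IsSymplectic.andreStar_mul_self (hω : IsSymplectic ω g) : andreStar ω g * andreStar ω g = 1 := by
  haveI := hω.finiteDimensional_exteriorAlgebra
  rw [hω.andreStar_eq]
  exact hω.hasLefschetzProperty_mul.andreHodgeInvolution_mul_self _ g

/-- **`w⁴ = 1`.** [cite: Andre1996Motifs, §1.2 (p. 11)] -/
theorem IsSymplectic.weylStar_pow_four (hω : IsSymplectic ω g) : weylStar ω g ^ 4 = 1 := by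
  haveI := hω.finiteDimensional_exteriorAlgebra
  rw [hω.weylStar_eq]
  exact hω.hasLefschetzProperty_mul.weylOperator_pow_four _

/-- **`w² = (−1)^{k+g}` on `⋀ᵏ W`** (the central `−1 ∈ SL₂` acts on the weight `k − g` by `(−1)^{k−g}`). [cite: Andre1996Motifs, §1.2 (p. 11)] -/
theorem IsSymplectic.weylStar_weylStar_apply_of_mem (hω : IsSymplectic ω g) {k : ℕ} {x : ExteriorAlgebra K W} (hx : x ∈ ⋀[K]^k W) :
    weylStar ω g (weylStar ω g x) = ((-1 : K) ^ (k + g)) • x := by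
  haveI := hω.finiteDimensional_exteriorAlgebra
  have h1 := hω.hasLefschetzProperty_mul.weylOperator_weylOperator_apply_of_mem (isZGrading_shiftedDegree K (fun i : ℕ ↦ ⋀[K]^i W) g)
    (m := (k : ℤ) - g) (x := x) (by rw [degreeSpace_shiftedDegree_eq_exteriorPower g ((k : ℤ) - g) k (by omega)]; exact hx)
  rw [hω.weylStar_eq, h1, neg_one_pow_eq_of_even_add (b := k + g) (by rw [Nat.even_iff]; omega)]

/-- `w` maps `⋀ᵏ W` into `⋀ˡ W`, `k + l = 2g`. [cite: Andre1996Motifs, §1.2 (p. 11)] -/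
theorem IsSymplectic.weylStar_apply_mem (hω : IsSymplectic ω g) {k l : ℕ} (hkl : k + l = 2 * g) {x : ExteriorAlgebra K W}
    (hx : x ∈ ⋀[K]^k W) : weylStar ω g x ∈ ⋀[K]^l W := by
  haveI := hω.finiteDimensional_exteriorAlgebra
  rw [hω.weylStar_eq, ← degreeSpace_shiftedDegree_eq_exteriorPower g (-((k : ℤ) - g)) l (by omega)]
  exact hω.hasLefschetzProperty_mul.weylOperator_apply_mem _ (m := (k : ℤ) - g)
    (by rw [degreeSpace_shiftedDegree_eq_exteriorPower g _ k (by omega)]; exact hx)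

/-- `*_H` maps `⋀ᵏ W` into `⋀ˡ W`, `k + l = 2g`. [cite: Andre1996Motifs, §1.1 (p. 10)] -/
theorem IsSymplectic.andreStar_apply_mem (hω : IsSymplectic ω g) {k l : ℕ} (hkl : k + l = 2 * g) {x : ExteriorAlgebra K W}
    (hx : x ∈ ⋀[K]^k W) : andreStar ω g x ∈ ⋀[K]^l W := by
  haveI := hω.finiteDimensional_exteriorAlgebra
  rw [hω.andreStar_eq, ← degreeSpace_shiftedDegree_eq_exteriorPower g (-((k : ℤ) - g)) l (by omega)]
  exact hω.hasLefschetzProperty_mul.andreHodgeInvolution_apply_mem _ g (m := (k : ℤ) - g)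
    (by rw [degreeSpace_shiftedDegree_eq_exteriorPower g _ k (by omega)]; exact hx)

end Formulas

/-! ## §2 The `𝔰𝔩₂`-relations of `w` and the algebra `K[e_ω, Λ_ω]` -/

section Relations

variable {K : Type u} [Field K] [CharZero K] {W : Type v} [AddCommGroup W] [Module K W]
variable {ω : ExteriorAlgebra K W} {g : ℕ}

/-- **`w e_ω = −Λ_ω w`** (`g ≥ 1`: `(0 1 ; −1 0)` conjugates `L ↦ (0 0 ; 1 0)` into `−ᶜΛ`). [cite: Andre1996Motifs, §1.2 (p. 11)] [cite: LooijengaLunts1997, §3 (3.3) (p. 13, f_κ)] -/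
theorem IsSymplectic.weylStar_mul_mul (hω : IsSymplectic ω g) (hg : 0 < g) :
    weylStar ω g * LinearMap.mul K (ExteriorAlgebra K W) ω = -(lefschetzDual ω g * weylStar ω g) := by
  haveI := hω.finiteDimensional_exteriorAlgebra
  rw [hω.weylStar_eq, ← hω.dual_eq_lefschetzDual hg]
  exact hω.hasLefschetzProperty_mul.weylOperator_mul_e _

/-- **`w Λ_ω = −e_ω w`** (`g ≥ 1`). [cite: Andre1996Motifs, §1.2 (p. 11)] [cite: LooijengaLunts1997, §3 (3.3) (p. 13)] -/
theorem IsSymplectic.weylStar_mul_lefschetzDual (hω : IsSymplectic ω g) (hg : 0 < g) :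
    weylStar ω g * lefschetzDual ω g = -(LinearMap.mul K (ExteriorAlgebra K W) ω * weylStar ω g) := by
  haveI := hω.finiteDimensional_exteriorAlgebra
  rw [hω.weylStar_eq, ← hω.dual_eq_lefschetzDual hg]
  exact hω.hasLefschetzProperty_mul.weylOperator_mul_dual _

/-- **`w h = −h w`**: `w` reverses the grading `h = l − g`. [cite: Andre1996Motifs, §1.2 (p. 11)] -/
theorem IsSymplectic.weylStar_mul_shiftedDegree (hω : IsSymplectic ω g) :
    weylStar ω g * shiftedDegree K (fun i : ℕ ↦ ⋀[K]^i W) g = -(shiftedDegree K (fun i : ℕ ↦ ⋀[K]^i W) g * weylStar ω g) := by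
  haveI := hω.finiteDimensional_exteriorAlgebra
  rw [hω.weylStar_eq]
  exact hω.hasLefschetzProperty_mul.weylOperator_mul_h _

/-- **`*_H e_ω *_H = Λ_ω` EXACTLY** (`g ≥ 1`): with André's factor, conjugating `L = e_ω` by `*_H` gives the `𝔰𝔩₂`-partner `ᶜΛ = Λ_ω =
Σ i(fᵢ*) i(eᵢ*)` itself, not only an operator "proportionnel à `ᶜΛ` sur chaque composante de Lefschetz" (which is what `*_L` and Milne's
`∗` give, `lefschetzDual_pow_succ_mul_eq_smul_conj` of g29-#4). [cite: Andre1996Motifs, §1.1 (pp. 10–11)] [cite: Milne1999LefschetzClasses, §5 p. 664 (ᶜΛ)] [cite: LooijengaLunts1997, §3 (3.3) (p. 13)] -/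
theorem IsSymplectic.andreStar_mul_mul_andreStar (hω : IsSymplectic ω g) (hg : 0 < g) :
    andreStar ω g * LinearMap.mul K (ExteriorAlgebra K W) ω * andreStar ω g = lefschetzDual ω g := by
  haveI := hω.finiteDimensional_exteriorAlgebra
  rw [hω.andreStar_eq, ← hω.dual_eq_lefschetzDual hg]
  exact hω.hasLefschetzProperty_mul.andreHodgeInvolution_mul_e_mul_andreHodgeInvolution _ g

/-- **`w ∈ K[e_ω, *_L]`** (`= K[e_ω, Λ_ω] = K[e_ω, ∗]`, rows g30-#1/#2). [cite: Andre1996Motifs, Prop. 1.2 (p. 11)] [cite: Milne1999LefschetzClasses, §5 Thm. 5.9 (proof, p. 665)] -/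
theorem IsSymplectic.weylStar_mem_adjoin_lefschetzStar (hω : IsSymplectic ω g) :
    weylStar ω g ∈ Algebra.adjoin K ({LinearMap.mul K (ExteriorAlgebra K W) ω, lefschetzStar ω g} : Set (Module.End K (ExteriorAlgebra K W))) := by
  haveI := hω.finiteDimensional_exteriorAlgebra
  have h1 := hω.hasLefschetzProperty_mul.weylOperator_mem_adjoin_pair_dual (isZGrading_shiftedDegree K (fun i : ℕ ↦ ⋀[K]^i W) g)
  rw [← hω.hasLefschetzProperty_mul.adjoin_pair_lefschetzInvolution_eq_adjoin_pair_dual] at h1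
  rw [hω.weylStar_eq, hω.lefschetzStar_eq]
  exact h1

/-- **`*_H ∈ K[e_ω, *_L]`.** [cite: Andre1996Motifs, Prop. 1.2 (p. 11)] -/
theorem IsSymplectic.andreStar_mem_adjoin_lefschetzStar (hω : IsSymplectic ω g) :
    andreStar ω g ∈ Algebra.adjoin K ({LinearMap.mul K (ExteriorAlgebra K W) ω, lefschetzStar ω g} : Set (Module.End K (ExteriorAlgebra K W))) := by
  rw [hω.andreStar_eq, hω.lefschetzStar_eq]
  exact hω.hasLefschetzProperty_mul.andreHodgeInvolution_mem_adjoin _ g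

/-- **`w ∈ K[e_ω, Λ_ω]`** (`g ≥ 1`). [cite: Andre1996Motifs, Prop. 1.2 (p. 11)] [cite: Milne1999LefschetzClasses, §5 Thm. 5.9 (proof, p. 665)] -/
theorem IsSymplectic.weylStar_mem_adjoin_lefschetzDual (hω : IsSymplectic ω g) (hg : 0 < g) :
    weylStar ω g ∈ Algebra.adjoin K ({LinearMap.mul K (ExteriorAlgebra K W) ω, lefschetzDual ω g} : Set (Module.End K (ExteriorAlgebra K W))) := by
  haveI := hω.finiteDimensional_exteriorAlgebra
  rw [hω.weylStar_eq, ← hω.dual_eq_lefschetzDual hg]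
  exact hω.hasLefschetzProperty_mul.weylOperator_mem_adjoin_pair_dual _

/-- **André's Prop. 1.2 on `⋀ W` for his own `*_H`: `K[e_ω, *_H] = K[e_ω, Λ_ω]`** (`g ≥ 1`). [cite: Andre1996Motifs, Prop. 1.2 (p. 11)] -/
theorem IsSymplectic.adjoin_pair_andreStar_eq_adjoin_pair_lefschetzDual (hω : IsSymplectic ω g) (hg : 0 < g) :
    Algebra.adjoin K ({LinearMap.mul K (ExteriorAlgebra K W) ω, andreStar ω g} : Set (Module.End K (ExteriorAlgebra K W))) =
      Algebra.adjoin K ({LinearMap.mul K (ExteriorAlgebra K W) ω, lefschetzDual ω g} : Set (Module.End K (ExteriorAlgebra K W))) := by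
  haveI := hω.finiteDimensional_exteriorAlgebra
  rw [hω.andreStar_eq, ← hω.dual_eq_lefschetzDual hg]
  exact hω.hasLefschetzProperty_mul.adjoin_pair_andreHodgeInvolution_eq_adjoin_pair_dual _ g

end Relations

/-! ## §3 "l'élément `(0 1 ; −1 0)` de `SL₂` s'envoie sur `± *_H`": `*_H = (−1)^{g + C(k,2)} w` on `⋀ᵏ W` -/

section Sign

variable {K : Type u} [Field K] [CharZero K] {W : Type v} [AddCommGroup W] [Module K W]
variable {ω : ExteriorAlgebra K W} {g : ℕ}

/-- **`*_H x = (−1)^{g + k(k−1)/2} · w x` for `x ∈ ⋀ᵏ W`** (`k(k−1)/2 = C(k, 2)`): André's "l'élément `(0 1 ; −1 0)` de `SL₂` s'envoie sur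
`± *_H`, le signe étant `(−1)^{…}` sur la composante `Hᵏ`", on the exterior algebra (`d = g`, depth `g`).
[cite: Andre1996Motifs, §1.2 (p. 11)] -/
theorem IsSymplectic.andreStar_apply_of_mem (hω : IsSymplectic ω g) {k : ℕ} {x : ExteriorAlgebra K W} (hx : x ∈ ⋀[K]^k W) :
    andreStar ω g x = ((-1 : K) ^ (g + k.choose 2)) • weylStar ω g x := by
  haveI := hω.finiteDimensional_exteriorAlgebra
  rw [hω.andreStar_eq, hω.weylStar_eq]
  exact hω.hasLefschetzProperty_mul.andreHodgeInvolution_apply_of_mem_degreeSpace _ (le_of_eq hω.depth_shiftedDegree_eq)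
    (m := (k : ℤ) - g) (n := k) (by omega) (by rw [degreeSpace_shiftedDegree_eq_exteriorPower g ((k : ℤ) - g) k (by omega)]; exact hx)

/-- … and conversely `w x = (−1)^{g + C(k,2)} · *_H x` on `⋀ᵏ W`. [cite: Andre1996Motifs, §1.2 (p. 11)] -/
theorem IsSymplectic.weylStar_apply_of_mem (hω : IsSymplectic ω g) {k : ℕ} {x : ExteriorAlgebra K W} (hx : x ∈ ⋀[K]^k W) :
    weylStar ω g x = ((-1 : K) ^ (g + k.choose 2)) • andreStar ω g x := by
  rw [hω.andreStar_apply_of_mem hx, smul_smul, ← pow_add, ← two_mul, pow_mul, neg_one_sq, one_pow, one_smul]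

end Sign

/-! ## §4 `Sp(ω)`-equivariance of `w` and `*_H` -/

section Equivariance

variable {K : Type u} [Field K] [CharZero K] {W : Type v} [AddCommGroup W] [Module K W]
variable {ω : ExteriorAlgebra K W} {g : ℕ}

/-- **`w` is `Sp(ω)`-equivariant: `⋀(f) (w x) = w (⋀(f) x)`** for every `f : W → W` with `⋀(f) ω = ω` (`⋀(f)` commutes with `e_ω` and with
`h`, hence with `*_L`, hence with `Λ_ω ∈ K[e_ω, *_L]`, hence with the exponentials). [cite: Milne1999LefschetzClasses, §5 Thm. 5.9 (proof, p. 665)] [cite: Lange2023AbelianVarietiesComplex, §7.3.2 (1)–(2) (p. 338)] -/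
theorem IsSymplectic.map_weylStar (hω : IsSymplectic ω g) (f : W →ₗ[K] W) (hf : ExteriorAlgebra.map f ω = ω)
    (x : ExteriorAlgebra K W) : ExteriorAlgebra.map f (weylStar ω g x) = weylStar ω g (ExteriorAlgebra.map f x) := by
  haveI := hω.finiteDimensional_exteriorAlgebra
  set L := hω.hasLefschetzProperty_mul
  set hgr := isZGrading_shiftedDegree K (fun i : ℕ ↦ ⋀[K]^i W) g
  have hdual : Commute (ExteriorAlgebra.map f).toLinearMap (L.dual hgr) :=
    HasLefschetzProperty.commute_of_mem_adjoin_pair (commute_map_mul f hf)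
      (L.commute_lefschetzInvolution hgr (commute_map_shiftedDegree f g) (commute_map_mul f hf)) (L.dual_mem_adjoin_lefschetzInvolution hgr)
  have h1 := L.commute_weylOperator hgr (commute_map_mul f hf) hdual
  have h2 := LinearMap.congr_fun h1.eq x
  rw [Module.End.mul_apply, Module.End.mul_apply, AlgHom.toLinearMap_apply, AlgHom.toLinearMap_apply, ← hω.weylStar_eq] at h2
  exact h2

/-- **André's `*_H` is `Sp(ω)`-equivariant: `⋀(f) (*_H x) = *_H (⋀(f) x)`** for `⋀(f) ω = ω`. [cite: Milne1999LefschetzClasses, §5 Thm. 5.9 (proof, p. 665)] [cite: Lange2023AbelianVarietiesComplex, §7.3.2 (1)–(2) (p. 338)] -/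
theorem IsSymplectic.map_andreStar (hω : IsSymplectic ω g) (f : W →ₗ[K] W) (hf : ExteriorAlgebra.map f ω = ω)
    (x : ExteriorAlgebra K W) : ExteriorAlgebra.map f (andreStar ω g x) = andreStar ω g (ExteriorAlgebra.map f x) := by
  haveI := hω.finiteDimensional_exteriorAlgebra
  have h1 := hω.hasLefschetzProperty_mul.commute_andreHodgeInvolution (isZGrading_shiftedDegree K (fun i : ℕ ↦ ⋀[K]^i W) g) g
    (commute_map_shiftedDegree f g) (commute_map_mul f hf)
  have h2 := LinearMap.congr_fun h1.eq x
  rw [Module.End.mul_apply, Module.End.mul_apply, AlgHom.toLinearMap_apply, AlgHom.toLinearMap_apply] at h2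
  rw [hω.andreStar_eq]
  exact h2

end Equivariance

end Literature.AlgebraicGeometry.Motives.ExteriorLefschetz
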